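import Summits.BirchSwinnertonDyer.BirchSwinnertonDyer.Theorems.PrintCf2RubinValueTwoBrickCD4ChiDefs
import HarnessLib

/-!
# Brick (c) at `p = 2`, ITEM «D4χ»: the product rule `σ̃_𝔞·y_χ(𝔠) = y_χ(𝔞𝔠)·(y_χ(𝔞)⁻¹)^{N𝔠}` for the averaged elliptic units and the
# `Γ_{K_v}`-stability of `A_χ = closure ⟨y_χ(𝔞)^{±1}⟩` (de Shalit II.2.4 (ii), II.4.12, III.1.4)

Cell `bsd-print-cf2`, width seat `bsd-line-cf2c-w7` g25, route C `PrintCf2RubinValueTwo`, crux of record stmt-BirchSwinnertonDyer-24033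
`TwoVariableMainConjAtSplitTwoQuad` (23720 nominal), BRICK §4(c); `--supports` the crux as a helper.  Sequel of `…BrickCD4ChiDefs` (the typed item D4χ):
the item's conclusion quantifies `∃ … (hAgal : ∀ τ, ∀ β ∈ A_χ, τ·β ∈ A_χ), …` with `A_χ = closure ⟨y_χ(𝔞)^{±1} : 𝔞 liftable⟩`,
`y_χ(𝔞) = ∏_j signedPow (c j) ⟨e_{t_j}(𝔞)⟩` (`averagedEllipticUnits`).  THIS file supplies the product rule from which `hAgal` follows by the lane's
density lemma `galAct_mem_closure_unitsGen_of_mul_rule` + `galAct_mem_closure_unitsGen`: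

* §1 components of products / powers / signed powers / Galois translates of families of relative norm-coherent units, as field elements
  (`coe_val_mul_apply`, `coe_val_pow_apply`, `coe_val_prod_apply`, `coe_val_signedPow_apply`, `coe_val_galAct_apply`);
* §2 ★★ `hrule_averagedEllipticUnits`: `σ̃_𝔞·y_χ(𝔠) = y_χ(𝔞𝔠)·(y_χ(𝔞)⁻¹)^{N𝔠}` over the liftable ideals — the per-conjugate rule
  `EllipticUnitsConj₂.galAct_ellipticUnitsPrincipalConj₂_eq` (II.2.4 (ii) transported through `t·`) multiplied out componentwise (signed products
  commute with the termwise Galois action, which is a field automorphism on each component);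
* §2 ★★ `galAct_mem_closure_averagedEllipticUnits`: `A_χ` is `Γ_{K_v}`-stable — the item's `hAgal` literally, from the frame's inertia / counting
  data `hinert`, `hcount` (T15's `towerDataOffset_hinert_of_level`, `towerDataOffset_hcount`) through `happrox_of_isLocArtinLiftable`.

Theorems only; no named fact (the de Shalit prints `prop24_iii_unit`, `prop25_i_normRelation`, `prop24_ii_galoisAction` are hypotheses, as in the lane),
no `sorry`, no instance.  BSD is not proved by any of this; nothing here closes 24033.

## References
* [deShalit1987] E. de Shalit, *Iwasawa theory of elliptic curves with complex multiplication* (1987), Ch. I §2.3 (i), (iv); II.2.4 Proposition (ii);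
  II.4.12 (p. 66–68); III.1.3–1.4.
* [Rubin1991] K. Rubin, *The "main conjectures" of Iwasawa theory for imaginary quadratic fields*, Invent. Math. 103 (1991), §1 p. 29, §4 p. 36.
-/

noncomputable section

set_option linter.dupNamespace false
set_option autoImplicit false

open Filter Topology
open scoped PowerSeries.WithPiTopology
open scoped NumberField Classical

namespace Summit.BirchSwinnertonDyer.BirchSwinnertonDyer.Theorems.PrintCf2.BrickCD4Chi

open Field IsDedekindDomain IsDedekindDomain.HeightOneSpectrum ValuativeRel WithZero
open Literature.NumberTheory.NumberFields
open Literature.NumberTheory.GaloisRepresentations Literature.NumberTheory.GaloisRepresentations.IsNonarchimedeanLocalField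
  Literature.NumberTheory.GaloisRepresentations.LubinTate Literature.NumberTheory.GaloisRepresentations.ArtinLocalGlobal
open Literature.NumberTheory.EllipticCurves
open Literature.NumberTheory.ComplexMultiplication.EllipticUnits
open Literature.NumberTheory.Automorphic
open Literature.NumberTheory.LFunctions.AbelianDensity (artinSymbol)
open Summit.BirchSwinnertonDyer.BirchSwinnertonDyer.Theorems.PrintCf2.EllipticUnitsConj₂
open Summit.BirchSwinnertonDyer.BirchSwinnertonDyer.Theorems.PrintCf2.ColemanCoinvariantTraceEllipticUnitsTowerDataOffset
open Summit.BirchSwinnertonDyer.BirchSwinnertonDyer.Theorems.PrintCf2.ColemanCoinvariantTraceEllipticUnitsTowerDataOffsetIndex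
open Summit.BirchSwinnertonDyer.BirchSwinnertonDyer.Theorems.PrintCf2.ColemanCoinvariantTraceEllipticUnitsTowerDataOffsetMoment
open Summit.BirchSwinnertonDyer.BirchSwinnertonDyer.Theorems.PrintCf2.ColemanCoinvariantTraceEllipticUnitsTowerDataOffsetLevelEllipticMoment
open Summit.BirchSwinnertonDyer.BirchSwinnertonDyer.Theorems.PrintCf2.ColemanCoinvariantTraceEllipticUnitsFrameDischarged
open Summit.BirchSwinnertonDyer.BirchSwinnertonDyer.Theorems.PrintCf2.ColemanCoinvariantTraceEllipticUnitsFrameDischargedSplit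

variable {K : Type} [Field K] [NumberField K] {𝔤₀ : Ideal (𝓞 K)} {v v' : HeightOneSpectrum (𝓞 K)}

attribute [local instance] ltNormUniformSpace ltNormIsUniformAddGroup rk1 nF nE fintypeResidueField
attribute [local instance] RelNormCoherentUnits.instCommMonoid

/-! ### §1. Components of products, powers, signed powers and Galois translates of families -/

section Components

variable {F₀ : Type} [Field F₀] [ValuativeRel F₀] [TopologicalSpace F₀] [IsNonarchimedeanLocalField F₀]
  {π₀ : 𝒪[F₀]} {hπ₀ : (valuation F₀).IsUniformizer (π₀ : F₀)} {E₀ : ℕ → IntermediateField F₀ (AlgebraicClosure F₀)}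
  [∀ m, FiniteDimensional F₀ (E₀ m)]

/-- Components of a product of families. [cite: deShalit1987, Ch. I §2.3 (i)] -/
theorem coe_val_mul_apply (f g : ∀ m, RelNormCoherentUnits hπ₀ (E₀ m)) (m m' : ℕ) :
    ((((f * g) m).val m' : unitBall (E₀ m ⊔ ltField π₀ m' : IntermediateField F₀ (AlgebraicClosure F₀))) :
      (E₀ m ⊔ ltField π₀ m' : IntermediateField F₀ (AlgebraicClosure F₀))) =
    (((f m).val m' : unitBall (E₀ m ⊔ ltField π₀ m' : IntermediateField F₀ (AlgebraicClosure F₀))) :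
      (E₀ m ⊔ ltField π₀ m' : IntermediateField F₀ (AlgebraicClosure F₀))) *
    (((g m).val m' : unitBall (E₀ m ⊔ ltField π₀ m' : IntermediateField F₀ (AlgebraicClosure F₀))) :
      (E₀ m ⊔ ltField π₀ m' : IntermediateField F₀ (AlgebraicClosure F₀))) := rfl

/-- Components of the unit family. [cite: deShalit1987, Ch. I §2.3 (i)] -/
theorem coe_val_one_apply (m m' : ℕ) :
    ((((1 : ∀ m, RelNormCoherentUnits hπ₀ (E₀ m)) m).val m' : unitBall (E₀ m ⊔ ltField π₀ m' : IntermediateField F₀ (AlgebraicClosure F₀))) :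
      (E₀ m ⊔ ltField π₀ m' : IntermediateField F₀ (AlgebraicClosure F₀))) = 1 := rfl

/-- Components of a power of a family. [cite: deShalit1987, Ch. I §2.3 (i)] -/
theorem coe_val_pow_apply (f : ∀ m, RelNormCoherentUnits hπ₀ (E₀ m)) (n m m' : ℕ) :
    ((((f ^ n) m).val m' : unitBall (E₀ m ⊔ ltField π₀ m' : IntermediateField F₀ (AlgebraicClosure F₀))) :
      (E₀ m ⊔ ltField π₀ m' : IntermediateField F₀ (AlgebraicClosure F₀))) =
    (((f m).val m' : unitBall (E₀ m ⊔ ltField π₀ m' : IntermediateField F₀ (AlgebraicClosure F₀))) :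
      (E₀ m ⊔ ltField π₀ m' : IntermediateField F₀ (AlgebraicClosure F₀))) ^ n := by
  induction n with
  | zero => rw [pow_zero, pow_zero]; rfl
  | succ n ih => rw [pow_succ, pow_succ, coe_val_mul_apply, ih]

/-- Components of a finite product of families. [cite: deShalit1987, Ch. I §2.3 (i)] -/
theorem coe_val_prod_apply {ι : Type} (s : Finset ι) (g : ι → ∀ m, RelNormCoherentUnits hπ₀ (E₀ m)) (m m' : ℕ) :
    ((((∏ i ∈ s, g i) m).val m' : unitBall (E₀ m ⊔ ltField π₀ m' : IntermediateField F₀ (AlgebraicClosure F₀))) :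
      (E₀ m ⊔ ltField π₀ m' : IntermediateField F₀ (AlgebraicClosure F₀))) =
    ∏ i ∈ s, (((g i m).val m' : unitBall (E₀ m ⊔ ltField π₀ m' : IntermediateField F₀ (AlgebraicClosure F₀))) :
      (E₀ m ⊔ ltField π₀ m' : IntermediateField F₀ (AlgebraicClosure F₀))) := by
  induction s using Finset.induction_on with
  | empty => rw [Finset.prod_empty, Finset.prod_empty]; rfl
  | insert a s ha ih => rw [Finset.prod_insert ha, Finset.prod_insert ha, coe_val_mul_apply, ih]

/-- Components of the termwise inverse family. [cite: deShalit1987, Ch. I §2.3 (i)] -/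
theorem coe_val_inv_apply (f : ∀ m, RelNormCoherentUnits hπ₀ (E₀ m)) (m m' : ℕ) :
    ((((fun m ↦ (f m).inv hπ₀ (E₀ m)) m).val m' : unitBall (E₀ m ⊔ ltField π₀ m' : IntermediateField F₀ (AlgebraicClosure F₀))) :
      (E₀ m ⊔ ltField π₀ m' : IntermediateField F₀ (AlgebraicClosure F₀))) =
    ((((f m).val m' : unitBall (E₀ m ⊔ ltField π₀ m' : IntermediateField F₀ (AlgebraicClosure F₀))) :
      (E₀ m ⊔ ltField π₀ m' : IntermediateField F₀ (AlgebraicClosure F₀))))⁻¹ := rfl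

/-- Components of a signed power: `(signedPow c β)_{m,m'} = β_{m,m'}^{c}` (`c = ±1`, an integer power in the field). [cite: deShalit1987, Ch. I §2.3 (i)] -/
theorem coe_val_signedPow_apply (c : ℤˣ) (f : ∀ m, RelNormCoherentUnits hπ₀ (E₀ m)) (m m' : ℕ) :
    ((((signedPow c f) m).val m' : unitBall (E₀ m ⊔ ltField π₀ m' : IntermediateField F₀ (AlgebraicClosure F₀))) :
      (E₀ m ⊔ ltField π₀ m' : IntermediateField F₀ (AlgebraicClosure F₀))) =
    (((f m).val m' : unitBall (E₀ m ⊔ ltField π₀ m' : IntermediateField F₀ (AlgebraicClosure F₀))) :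
      (E₀ m ⊔ ltField π₀ m' : IntermediateField F₀ (AlgebraicClosure F₀))) ^ ((c : ℤˣ) : ℤ) := by
  rcases Int.units_eq_one_or c with rfl | rfl
  · rw [signedPow_one, Units.val_one, zpow_one]
  · rw [signedPow_neg_one, Units.val_neg, Units.val_one, zpow_neg, zpow_one]; rfl

/-- Components of a Galois translate: `(τ·β)_{m,m'} = τ|(β_{m,m'})`. [cite: deShalit1987, Ch. I §2.3 (iv)] -/
theorem coe_val_galAct_apply [∀ m, Normal F₀ (E₀ m)] (f : ∀ m, RelNormCoherentUnits hπ₀ (E₀ m)) (τ : absoluteGaloisGroup F₀) (m m' : ℕ) :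
    ((((fun m ↦ (f m).galAct τ) m).val m' : unitBall (E₀ m ⊔ ltField π₀ m' : IntermediateField F₀ (AlgebraicClosure F₀))) :
      (E₀ m ⊔ ltField π₀ m' : IntermediateField F₀ (AlgebraicClosure F₀))) =
    relRestrict hπ₀ (E₀ m) m' τ (((f m).val m' : unitBall (E₀ m ⊔ ltField π₀ m' : IntermediateField F₀ (AlgebraicClosure F₀))) :
      (E₀ m ⊔ ltField π₀ m' : IntermediateField F₀ (AlgebraicClosure F₀))) := rfl

/-- Two families with the same components are equal. [cite: deShalit1987, Ch. I §2.3 (i)] -/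
theorem family_ext {f g : ∀ m, RelNormCoherentUnits hπ₀ (E₀ m)}
    (h : ∀ m m', (((f m).val m' : unitBall (E₀ m ⊔ ltField π₀ m' : IntermediateField F₀ (AlgebraicClosure F₀))) :
      (E₀ m ⊔ ltField π₀ m' : IntermediateField F₀ (AlgebraicClosure F₀))) =
      (((g m).val m' : unitBall (E₀ m ⊔ ltField π₀ m' : IntermediateField F₀ (AlgebraicClosure F₀))) :
      (E₀ m ⊔ ltField π₀ m' : IntermediateField F₀ (AlgebraicClosure F₀)))) : f = g :=
  funext fun m ↦ RelNormCoherentUnits.ext fun m' ↦ Subtype.ext (h m m')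

/-- The algebra behind the product rule for signed products: in a field, if `ρ(e_j) = a_j·(b_j⁻¹)^N` for all `j`, then
`ρ(∏_j e_j^{c_j}) = (∏_j a_j^{c_j}) · ((∏_j b_j^{c_j})⁻¹)^N`. [cite: deShalit1987, Ch. II §2.4 (ii)] -/
theorem map_prod_zpow_eq_of_rule {L : Type} [Field L] {J : Type} [Fintype J] (ρ : L ≃+* L) (e a b : J → L) (c : J → ℤˣ) (N : ℕ)
    (h : ∀ j, ρ (e j) = a j * ((b j)⁻¹) ^ N) :
    ρ (∏ j, e j ^ ((c j : ℤˣ) : ℤ)) = (∏ j, a j ^ ((c j : ℤˣ) : ℤ)) * ((∏ j, b j ^ ((c j : ℤˣ) : ℤ))⁻¹) ^ N := by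
  rw [map_prod]
  simp_rw [map_zpow₀, h, mul_zpow, Finset.prod_mul_distrib]
  congr 1
  rw [← Finset.prod_inv_distrib, ← Finset.prod_pow]
  refine Finset.prod_congr rfl fun j _ ↦ ?_
  rw [← zpow_natCast, ← zpow_natCast, ← zpow_mul, mul_comm, zpow_mul, inv_zpow]

end Components

/-! ### §2. The product rule for the averaged elliptic units -/

section Rule

variable [NumberField.IsTotallyComplex K]
  (h24iii : DeShalit1987.prop24_iii_unit) (h25 : DeShalit1987.prop25_i_normRelation) (h24ii : DeShalit1987.prop24_ii_galoisAction)
  (hK : IsImaginaryQuadratic K) (ιK : K →+* ℂ)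
  (h𝔤0 : 𝔤₀ ≠ ⊥) (hv : ¬ 𝔤₀ ≤ v.asIdeal) (hv' : ¬ 𝔤₀ ≤ v'.asIdeal) (hvv' : v' ≠ v) (hw𝔤 : ∀ u : (𝓞 K)ˣ, (u : 𝓞 K) - 1 ∈ 𝔤₀ → u = 1)
  {p : ℕ} (hp : p.Prime) (hpv' : (p : 𝓞 K) ∈ v'.asIdeal) (hpv'2 : (p : 𝓞 K) ∉ v'.asIdeal ^ 2)
  {π : 𝒪[v.adicCompletion K]} (hπ : (valuation (v.adicCompletion K)).IsUniformizer (π : v.adicCompletion K))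
  {α : 𝓞 K} (hα0 : α ≠ 0) (hα𝔤 : α - 1 ∈ 𝔤₀) (hαw : ∀ w : HeightOneSpectrum (𝓞 K), w ≠ v → α ∉ w.asIdeal)
  {f : ℕ} (hαπ : ((α : K) : v.adicCompletion K) = (π : v.adicCompletion K) ^ f)
  (ν : ℕ) (ha2 : 2 ≤ ν + 1 ∨ p ≠ 2) (hαa : v'.intValuation (α ^ p - 1) = exp (-((ν + 1 : ℕ) : ℤ)))
  {d₀ r : ℕ} (hf : f = d₀ * p ^ r) [CharZero (v.adicCompletion K)]
  (E : ℕ → IntermediateField (v.adicCompletion K) (AlgebraicClosure (v.adicCompletion K)))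
  [∀ j, FiniteDimensional (v.adicCompletion K) (E j)] [∀ j, IsGalois (v.adicCompletion K) (E j)] (hmono : Monotone E)
  (hE : ∀ j, E j ≤ maxUnramified (v.adicCompletion K)) (hdeg : ∀ j, Module.finrank (v.adicCompletion K) (E j) = d₀ * p ^ j)
  {J : Type} [Fintype J] (t : J → absoluteGaloisGroup K) (c : J → ℤˣ)
  (x : ∀ a : {𝔞 : Ideal (𝓞 K) // IsLocArtinLiftable (𝔤₀ * v'.asIdeal ^ ν) v v' 𝔞}, ∀ i k : ℕ,
    rayClassField K (𝔤₀ * v'.asIdeal ^ ν * v'.asIdeal ^ (i + 1) * v.asIdeal ^ (k + 1)))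
  (hx : ∀ a, ∀ i k : ℕ, IsThetaValueOne ιK (𝔤₀ * v'.asIdeal ^ ν * v'.asIdeal ^ (i + 1) * v.asIdeal ^ (k + 1)) (a.1 : Ideal (𝓞 K))
    (algClosureEmb ιK ((x a i k : rayClassField K (𝔤₀ * v'.asIdeal ^ ν * v'.asIdeal ^ (i + 1) * v.asIdeal ^ (k + 1))) : AlgebraicClosure K)))
  (σ : {𝔞 : Ideal (𝓞 K) // IsLocArtinLiftable (𝔤₀ * v'.asIdeal ^ ν) v v' 𝔞} → absoluteGaloisGroup (v.adicCompletion K))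
  (hσ : ∀ a, ∀ i k : ℕ, absRestrictNormalHom (rayClassField K (𝔤₀ * v'.asIdeal ^ ν * v'.asIdeal ^ (i + 1) * v.asIdeal ^ (k + 1)))
      (absGaloisRestrict K (v.adicCompletion K) (σ a)) =
    artinSymbol (galFrob K (rayClassField K (𝔤₀ * v'.asIdeal ^ ν * v'.asIdeal ^ (i + 1) * v.asIdeal ^ (k + 1)))) (a.1 : Ideal (𝓞 K)))

include h24ii hσ in
/-- ★★ **The product rule for the averaged elliptic units**: over the liftable ideals (closed under products, `IsLocArtinLiftable.mul`), with theta
families `x_𝔞` and local Artin lifts `σ̃_𝔞`, `σ̃_𝔞·y_χ(𝔠) = y_χ(𝔞𝔠)·(y_χ(𝔞)⁻¹)^{N𝔠}` — the `hrule` of `galAct_mem_closure_unitsGen_of_mul_rule` for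
`y_χ = ∏_j signedPow (c j) ⟨e_{t_j}⟩` (the per-conjugate rule `galAct_ellipticUnitsPrincipalConj₂_eq`, II.2.4 (ii) transported through `t_j·`, multiplied out:
each component of `σ̃·β` is a field automorphism applied to the component of `β`). [cite: deShalit1987, II.2.4 Proposition (ii), II.4.12 (p. 66), III.1.4] -/
theorem hrule_averagedEllipticUnits (a b : {𝔞 : Ideal (𝓞 K) // IsLocArtinLiftable (𝔤₀ * v'.asIdeal ^ ν) v v' 𝔞}) :
    (fun m ↦ (averagedEllipticUnits h24iii h25 hK ιK h𝔤0 hv hv' hvv' hw𝔤 hp hpv' hpv'2 hπ hα0 hα𝔤 hαw hαπ ν ha2 hαa hf E hmono hE hdeg t c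
        b.2.1 b.2.2.1 (x b) (hx b) m).galAct (σ a)) =
      averagedEllipticUnits h24iii h25 hK ιK h𝔤0 hv hv' hvv' hw𝔤 hp hpv' hpv'2 hπ hα0 hα𝔤 hαw hαπ ν ha2 hαa hf E hmono hE hdeg t c
          (⟨a.1 * b.1, a.2.mul b.2⟩ : {𝔞 : Ideal (𝓞 K) // IsLocArtinLiftable (𝔤₀ * v'.asIdeal ^ ν) v v' 𝔞}).2.1
          (⟨a.1 * b.1, a.2.mul b.2⟩ : {𝔞 : Ideal (𝓞 K) // IsLocArtinLiftable (𝔤₀ * v'.asIdeal ^ ν) v v' 𝔞}).2.2.1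
          (x ⟨a.1 * b.1, a.2.mul b.2⟩) (hx ⟨a.1 * b.1, a.2.mul b.2⟩) *
        (fun m ↦ (averagedEllipticUnits h24iii h25 hK ιK h𝔤0 hv hv' hvv' hw𝔤 hp hpv' hpv'2 hπ hα0 hα𝔤 hαw hαπ ν ha2 hαa hf E hmono hE hdeg t c
          a.2.1 a.2.2.1 (x a) (hx a) m).inv hπ (E m)) ^ Ideal.absNorm (b.1 : Ideal (𝓞 K)) := by
  refine family_ext fun m m' ↦ ?_
  rw [coe_val_galAct_apply, coe_val_mul_apply, coe_val_pow_apply, coe_val_inv_apply]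
  unfold averagedEllipticUnits
  rw [coe_val_prod_apply, coe_val_prod_apply, coe_val_prod_apply]
  simp_rw [coe_val_signedPow_apply]
  refine map_prod_zpow_eq_of_rule ((relRestrict hπ (E m) m' (σ a)).toRingEquiv) _ _ _ c _ fun j ↦ ?_
  -- the per-conjugate rule `σ̃_𝔞·⟨e_{t_j}(𝔠)⟩ = ⟨e_{t_j}(𝔞𝔠)⟩·(⟨e_{t_j}(𝔞)⟩⁻¹)^{N𝔠}`, read off on the `(m, m')` component
  have h := congrArg
    (fun F : (∀ m, RelNormCoherentUnits hπ (E m)) ↦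
      (((F m).val m' : unitBall (E m ⊔ ltField π m' : IntermediateField (v.adicCompletion K) (AlgebraicClosure (v.adicCompletion K)))) :
        (E m ⊔ ltField π m' : IntermediateField (v.adicCompletion K) (AlgebraicClosure (v.adicCompletion K)))))
    (galAct_ellipticUnitsPrincipalConj₂_eq h24iii h25 hK ιK (mul_ne_zero h𝔤0 (pow_ne_zero ν v'.ne_bot)) (not_mul_pow_le₂₅ hv hvv' ν) hvv'
      (hw_of_towerData hw𝔤) hπ (towerData_hα0 (p := p) hα0) (towerData_hα𝔪 hv' hp hpv' hpv'2 hα𝔤 ha2 hαa) (towerData_hαw (p := p) hαw)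
      (towerData_hαπ (p := p) hαπ) E hmono (r + 1) (fun i ↦ hE (i + (r + 1))) (towerDataOffset_hdegE hf E hE hdeg) a.2.1 a.2.2.1 (t j) h24ii
      b.2.1 b.2.2.1 (a.2.mul b.2).2.1 (x a) (hx a) (x b) (hx b) (x ⟨a.1 * b.1, a.2.mul b.2⟩) (hx ⟨a.1 * b.1, a.2.mul b.2⟩) (σ a) (hσ a))
  simp only [coe_val_mul_apply, coe_val_pow_apply] at h
  exact h

include h24ii hσ in
/-- ★★ **`A_χ = closure ⟨y_χ(𝔞)^{±1} : 𝔞 liftable⟩` is `Γ_{K_v}`-stable** — the item's `hAgal`: the product rule `hrule_averagedEllipticUnits`, the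
layer approximation of `Γ_{K_v}` by the local Artin lifts of the liftable ideals (`happrox_of_isLocArtinLiftable`, from the frame's inertia / counting data
`hinert`, `hcount` exactly as in T15) and the lane's density lemmas `galAct_mem_closure_unitsGen_of_mul_rule` + `galAct_mem_closure_unitsGen`.
[cite: deShalit1987, II.2.4 Proposition (ii), II.4.12 (p. 66–68), III.1.4] -/
theorem galAct_mem_closure_averagedEllipticUnits
    (hinert : ∀ i, ∀ τ : absoluteGaloisGroup (v.adicCompletion K),
      (∀ y ∈ rayClassField K (𝔤₀ * v'.asIdeal ^ ν * v'.asIdeal ^ (i + 1)),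
        τ • absClosureEmbedding K (v.adicCompletion K) y = absClosureEmbedding K (v.adicCompletion K) y) →
        τ ∈ (E (i + (r + 1))).fixingSubgroup)
    (hcount : ∀ i k : ℕ, IntermediateField.relfinrank (rayClassField K (𝔤₀ * v'.asIdeal ^ ν * v'.asIdeal ^ (i + 1) * v.asIdeal ^ (k + 1)))
        (rayClassField K (𝔤₀ * v'.asIdeal ^ ν * v'.asIdeal ^ (i + 1 + 1) * v.asIdeal ^ (k + 1))) *
        Module.finrank (v.adicCompletion K) (E (i + (r + 1))) ≤ Module.finrank (v.adicCompletion K) (E (i + 1 + (r + 1))))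
    (τ : absoluteGaloisGroup (v.adicCompletion K)) :
    ∀ β ∈ closure (Submonoid.closure
        (Set.range (fun b : {𝔞 : Ideal (𝓞 K) // IsLocArtinLiftable (𝔤₀ * v'.asIdeal ^ ν) v v' 𝔞} ↦
            averagedEllipticUnits h24iii h25 hK ιK h𝔤0 hv hv' hvv' hw𝔤 hp hpv' hpv'2 hπ hα0 hα𝔤 hαw hαπ ν ha2 hαa hf E hmono hE hdeg t c
              b.2.1 b.2.2.1 (x b) (hx b)) ∪
          Set.range fun b : {𝔞 : Ideal (𝓞 K) // IsLocArtinLiftable (𝔤₀ * v'.asIdeal ^ ν) v v' 𝔞} ↦ fun j ↦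
            (averagedEllipticUnits h24iii h25 hK ιK h𝔤0 hv hv' hvv' hw𝔤 hp hpv' hpv'2 hπ hα0 hα𝔤 hαw hαπ ν ha2 hαa hf E hmono hE hdeg t c
              b.2.1 b.2.2.1 (x b) (hx b) j).inv hπ (E j)) : Set (∀ j, RelNormCoherentUnits hπ (E j))),
      (fun j ↦ (β j).galAct τ) ∈ closure (Submonoid.closure
        (Set.range (fun b : {𝔞 : Ideal (𝓞 K) // IsLocArtinLiftable (𝔤₀ * v'.asIdeal ^ ν) v v' 𝔞} ↦
            averagedEllipticUnits h24iii h25 hK ιK h𝔤0 hv hv' hvv' hw𝔤 hp hpv' hpv'2 hπ hα0 hα𝔤 hαw hαπ ν ha2 hαa hf E hmono hE hdeg t c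
              b.2.1 b.2.2.1 (x b) (hx b)) ∪
          Set.range fun b : {𝔞 : Ideal (𝓞 K) // IsLocArtinLiftable (𝔤₀ * v'.asIdeal ^ ν) v v' 𝔞} ↦ fun j ↦
            (averagedEllipticUnits h24iii h25 hK ιK h𝔤0 hv hv' hvv' hw𝔤 hp hpv' hpv'2 hπ hα0 hα𝔤 hαw hαπ ν ha2 hαa hf E hmono hE hdeg t c
              b.2.1 b.2.2.1 (x b) (hx b) j).inv hπ (E j)) : Set (∀ j, RelNormCoherentUnits hπ (E j))) :=
  galAct_mem_closure_unitsGen hπ E _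
    (galAct_mem_closure_unitsGen_of_mul_rule hπ E hmono _ σ
      (happrox_of_isLocArtinLiftable (mul_ne_zero h𝔤0 (pow_ne_zero ν v'.ne_bot)) (not_mul_pow_le₂₅ hv hvv' ν) hvv' (hw_of_towerData hw𝔤) hπ
        (towerData_hα0 (p := p) hα0) (towerData_hα𝔪 hv' hp hpv' hpv'2 hα𝔤 ha2 hαa) (towerData_hαw (p := p) hαw) (towerData_hαπ (p := p) hαπ) E hmono
        hE (r + 1) (towerDataOffset_hdegE hf E hE hdeg) hinert hcount σ hσ)
      (fun a b ↦ ⟨a.1 * b.1, a.2.mul b.2⟩) (fun b ↦ Ideal.absNorm (b.1 : Ideal (𝓞 K)))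
      (hrule_averagedEllipticUnits h24iii h25 h24ii hK ιK h𝔤0 hv hv' hvv' hw𝔤 hp hpv' hpv'2 hπ hα0 hα𝔤 hαw hαπ ν ha2 hαa hf E hmono hE hdeg t c
        x hx σ hσ)) τ

end Rule

end Summit.BirchSwinnertonDyer.BirchSwinnertonDyer.Theorems.PrintCf2.BrickCD4Chi

end
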